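import Summits.QuantumFields.BalabanUV.Beta.BorderedHessianSymmetry
import Summits.QuantumFields.BalabanUV.Beta.AxialDressingRootedBmHessian
import Summits.QuantumFields.BalabanUV.Beta.SpineRootedS0

/-!
# Sign-parity calculus for `bubble`: a sgn-symmetric propagator never couples a plain-antisymmetric OFF-DIAGONAL vertex to a
# plain-antisymmetric BLOCK-DIAGONAL one — and the consequence for the typed first-order spine `S0At` (β sub-cell, row BETA-an2,
# gen 14; kernel anchor of NOTE X-an2-45)

HONEST FRAMING (cell charter, verbatim): «discharging BetaPertH makes Balaban's UV stability UNCONDITIONAL — a real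
constructive-QFT result; it is NOT the continuum limit and NOT the Clay problem.»  DERIVED cell leaf (pub-balaban β sub-cell, lane
an2 gen 14); no statement of Bałaban's papers is typed here, no `[cite:]` tag, no `Prop` fact; it instantiates no binder of the
β-function wall.  NOT `BetaPertH`; NOT continuum; NOT Clay.

## What is here ([folklore] kernel algebra over the cell's `TameKernelCalculus`; every hypothesis explicit)

Write `sgnK` for the sign conjugation of `BorderedHessianSymmetry` (`(sgnK K) x y a b = sgnF a · sgnF b · K x y a b`, `sgnF = +1` on
field legs, `−1` on multiplier legs) and `trK` for transposition.  The packed resolvents of the cell are sgn-SYMMETRIC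
(`trK_KInv = sgnK KInv`: `Γ`, `wΦ` symmetric, `ℋ♭ = −ℋᵀ`), and so are the decimated and the block-mean co-dressed ones
(§3: `trK_KInvStep`, `trK_coDressKBmAt_KInvStep`).  The typed first-order stencils are PLAIN-antisymmetric (`SpineRooted.S0At_antisymm`).

* §1 parity algebra: `trK_eq_neg_of_antisymm`, `sgnK_eq_neg_of_offDiag` (a kernel supported on the field–multiplier blocks is
  NEGATED by `sgnK`), `sgnK_neg`, `tr_neg`, `tr_sgnK`, `comp_sgnK_right_of_eq_self/_of_eq_neg`, `comp_sgnK_left_of_eq_self`.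
* §2 **`bubble_eq_zero_of_parity`**: `Spr K`, `trK K = sgnK K`, `Loc V`, `Loc W`, `trK V = −V`, `trK W = −W`, `sgnK V = −V` (off-diagonal),
  `sgnK W = W` (block-diagonal) ⟹ `bubble K V W = 0`; and the mirrored `bubble_eq_zero_of_parity'` (`V` block-diagonal, `W` off-diagonal).
  Proof: `tr B = tr (trK B)` and `trK B = −sgnK ((W∘K)∘(V∘K))`, whose trace is `−tr B` by tame cyclicity/associativity.
* §3 the propagator side: `trK_dec`, `sgnK_dec`, `trK_KInvStep`, `sgnK_piKBm`, `trK_coDressKBmAt`, `trK_coDressKBmAt_KInvStep`.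
* §4 the vertex side: `vertexOfK` preserves zero patterns and plain antisymmetry (`vertexOfK_apply_eq_zero`, `trK_vertexOfK_of_antisymm`);
  the coefficient split `S0At_split : S0At ρ cE cVH cΛ = S0At ρ 0 cVH 0 + S0At ρ cE 0 cΛ` (vh-part + Wilson/Λ-part) with the block
  patterns `S0At_vh_inl_inl/_inr_inr` (the vh-part is OFF-DIAGONAL) and `S0At_wl_inl_inr/_inr_inl` (the Wilson/Λ-part is BLOCK-DIAGONAL).
* §5 **`bubble_S0At_vh_wl_eq_zero`** / **`bubble_S0At_wl_vh_eq_zero`**: for EVERY `j`, every in-block root `r`, all coefficients and all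
  coarse bonds, `bubble G_j (vertexOfK G_j Lc (S0At (toSite r) 0 cVH 0) μ y) (vertexOfK G_j Lc (S0At (toSite r) cE 0 cΛ) ν y′) = 0`,
  `G_j := coDressKBmAt (toSite r) Lc (KInvStep Lc j)` — in the one-loop bubble of the typed step kernels the field–multiplier («vh»)
  part of the first-order spine NEVER meets its Wilson/Λ part.

READING (context only; asserted nowhere below; NOTE X-an2-45 of the lane, `HOME/b2b-balaban-beta-an2/gen14/X-an2-45.md`): §5 is a
STRUCTURAL PROPERTY OF THE TYPED OBJECTS AS THEY STAND (the (F2) placement of `StepJetData` v1.1: `mfNeg (vhSAt …)`, plain-antisymmetric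
against the sgn-symmetric `KInv`).  For the symmetric bordered family whose `½∂² log det` the kernel `hessKer` is meant to compute such
cross terms are generically NON-zero (exact toy of the NOTE); whether §5 is a feature or a defect of the typed spine is for the β-lead /
an1 / an3 / an5 to rule — this file only certifies the fact.  All declarations `[folklore]`; axioms standard.
Provenance: b2b-balaban β sub-cell, unit beta-an2 gen 14, 2026-08-20 (v1); over `BorderedHessianSymmetry`, `AxialDressingRootedBm*`,
`SpineRootedS0`, `TameKernelCalculus` BY NAME; no existing file touched.
-/

open Finset
open scoped BigOperators
open Literature.Probability.LatticeModels (Torus.proj)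
open Literature.MathematicalPhysics.QuantumFieldTheory
open Literature.MathematicalPhysics.QuantumFieldTheory.Balaban1983to89
open Literature.MathematicalPhysics.QuantumFieldTheory.Balaban1983to89.Beta
open ExpKernelCalculus (MKer Decays BiLoc comp tr bubble VertexFamily)
open AffineAveraging (box toSite)
open OneStepResolventKernel (Fib KInv wsum LocStencil)
open OneStepKernelFamily (dec legSet legPt legW KInvStep decays_KInvStep colH vertexOfK vertexFamily_vertexOfK')
open InterLevelTransport (SLam cwsum onLat)
open StepJetData (wilsonA mfNeg mfNeg_inl_inl mfNeg_inr_inr)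
open AveragingHessianKernelsRooted (vhSAt hessFFAt)
open BalabanStepJets (lamCoeffOf)
open Summit.QuantumFields.BalabanUV.Beta.TameKernelCalculus
open Summit.QuantumFields.BalabanUV.Beta.BorderedHessian (sgnF sgnF_inl sgnF_inr sgnF_mul_self sgnK sgnK_apply sgnK_sgnK comp_sgnK
  trK_sgnK sgnK_eq_self trK_KInv)
open Summit.QuantumFields.BalabanUV.Beta.AxialDressingRooted (piKBm piKBm_inl_inr piKBm_inr_inl coDressKBmAt coDressKBmAt_eq spr_piKBm
  spr_trK_piKBm spr_coDressKBmAt spr_comp one_le_of_neZero decays_coDressKBmAt_KInvStep)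
open Summit.QuantumFields.BalabanUV.Beta.SpineRooted (S0At locStencil_S0At S0At_antisymm)

namespace Summit.QuantumFields.BalabanUV.Beta.BubbleParity

noncomputable section

variable {d : ℕ}

/-! ## §1 Parity algebra -/

section Parity

/-- [folklore] Plain antisymmetry as a transposition identity. -/
theorem trK_eq_neg_of_antisymm {K : MKer (d + 1) (Fib d)} (h : ∀ x z a b, K z x b a = -K x z a b) : trK K = -K := by
  funext x y a b
  simp only [trK_apply, Pi.neg_apply]
  exact h x y a b

/-- [folklore] A kernel supported on the field–multiplier blocks (field–field and multiplier–multiplier blocks zero) is NEGATED by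
the sign conjugation. -/
theorem sgnK_eq_neg_of_offDiag {K : MKer (d + 1) (Fib d)} (h1 : ∀ x y κ l, K x y (Sum.inl κ) (Sum.inl l) = 0)
    (h2 : ∀ x y κ l, K x y (Sum.inr κ) (Sum.inr l) = 0) : sgnK K = -K := by
  funext x y a b
  simp only [sgnK_apply, Pi.neg_apply]
  rcases a with κ | κ <;> rcases b with l | l
  · rw [h1]; simp
  · simp
  · simp
  · rw [h2]; simp

/-- [folklore] `sgnK (−K) = −sgnK K`. -/
theorem sgnK_neg (K : MKer (d + 1) (Fib d)) : sgnK (-K) = -sgnK K := by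
  funext x y a b
  simp only [sgnK_apply, Pi.neg_apply]
  ring

/-- [folklore] `tr (−K) = −tr K` (termwise; no summability needed). -/
theorem tr_neg {D : ℕ} {F : Type*} [Fintype F] (K : MKer D F) : tr (-K) = -tr K := by
  unfold ExpKernelCalculus.tr
  rw [← tsum_neg]
  refine tsum_congr fun x => ?_
  rw [← Finset.sum_neg_distrib]
  rfl

/-- [folklore] The trace does not see the sign conjugation (`sgnF a · sgnF a = 1` on the diagonal). -/
theorem tr_sgnK (K : MKer (d + 1) (Fib d)) : tr (sgnK K) = tr K := by
  unfold ExpKernelCalculus.tr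
  refine tsum_congr fun x => Finset.sum_congr rfl fun a _ => ?_
  rw [sgnK_apply, sgnF_mul_self, one_mul]

/-- [folklore] Right composition with `sgnK K` of an `sgnK`-FIXED kernel. -/
theorem comp_sgnK_right_of_eq_self {W : MKer (d + 1) (Fib d)} (hW : sgnK W = W) (K : MKer (d + 1) (Fib d)) :
    comp W (sgnK K) = sgnK (comp W K) := by
  have h : comp W (sgnK K) = comp (sgnK W) (sgnK K) := by rw [hW]
  rw [h, comp_sgnK]

/-- [folklore] Right composition with `sgnK K` of an `sgnK`-NEGATED kernel. -/
theorem comp_sgnK_right_of_eq_neg {V : MKer (d + 1) (Fib d)} (hV : sgnK V = -V) (K : MKer (d + 1) (Fib d)) :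
    comp V (sgnK K) = -sgnK (comp V K) := by
  have hV' : V = -sgnK V := by rw [hV, neg_neg]
  have h : comp V (sgnK K) = comp (-sgnK V) (sgnK K) := by rw [← hV']
  rw [h, comp_neg_left, comp_sgnK]

/-- [folklore] Left composition of `sgnK K` with an `sgnK`-fixed kernel. -/
theorem comp_sgnK_left_of_eq_self {W : MKer (d + 1) (Fib d)} (hW : sgnK W = W) (K : MKer (d + 1) (Fib d)) :
    comp (sgnK K) W = sgnK (comp K W) := by
  have h : comp (sgnK K) W = comp (sgnK K) (sgnK W) := by rw [hW]
  rw [h, comp_sgnK]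

end Parity

/-! ## §2 The parity lemma for `bubble` -/

section Bubble

/-- [folklore] **PARITY LEMMA.**  A sgn-symmetric spread propagator `K` (`trK K = sgnK K`) never couples, in
`bubble K V W = tr ((K∘V)∘(K∘W))`, a localised plain-antisymmetric OFF-DIAGONAL vertex `V` (`sgnK V = −V`) to a localised
plain-antisymmetric BLOCK-DIAGONAL vertex `W` (`sgnK W = W`): `bubble K V W = 0`. -/
theorem bubble_eq_zero_of_parity {K V W : MKer (d + 1) (Fib d)} (hK : Spr K) (hKt : trK K = sgnK K) (hV : Loc V) (hW : Loc W)
    (hVt : trK V = -V) (hWt : trK W = -W) (hVs : sgnK V = -V) (hWs : sgnK W = W) : bubble K V W = 0 := by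
  have hKW : Loc (comp K W) := hK.comp_loc hW
  have hVK : Loc (comp V K) := hV.comp_spr hK
  -- (1) the transpose of the bubble's argument
  have e1 : comp (-W) (sgnK K) = -sgnK (comp W K) := by rw [comp_neg_left, comp_sgnK_right_of_eq_self hWs]
  have e2 : comp (-V) (sgnK K) = sgnK (comp V K) := by rw [comp_neg_left, comp_sgnK_right_of_eq_neg hVs, neg_neg]
  have h1 : trK (comp (comp K V) (comp K W)) = -sgnK (comp (comp W K) (comp V K)) := by
    rw [trK_comp, trK_comp, trK_comp, hKt, hVt, hWt, e1, e2, comp_neg_left, comp_sgnK]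
  -- (2) tame cyclicity and re-association: `tr ((W∘K)∘(V∘K)) = tr ((K∘V)∘(K∘W))`
  have h2 : tr (comp (comp W K) (comp V K)) = tr (comp (comp K V) (comp K W)) := by
    have hZ : Loc (comp K (comp V K)) := hK.comp_loc hVK
    rw [← comp_assoc_tame hW.tame hK.tame hVK.tame, tr_comp_comm_loc hW hZ.tame,
      ← comp_assoc_tame hK.tame hVK.tame hW.tame, ← comp_assoc_tame hV.tame hK.tame hW.tame,
      comp_assoc_tame hK.tame hV.tame hKW.tame]
  -- (3) `tr B = tr (trK B) = −tr B`
  have h3 : tr (comp (comp K V) (comp K W)) = -tr (comp (comp K V) (comp K W)) := by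
    conv_lhs => rw [← tr_trK (comp (comp K V) (comp K W)), h1]
    rw [tr_neg, tr_sgnK, h2]
  unfold ExpKernelCalculus.bubble
  linarith

/-- [folklore] **PARITY LEMMA, mirrored**: `V` block-diagonal (`sgnK V = V`), `W` off-diagonal (`sgnK W = −W`) ⟹ `bubble K V W = 0`. -/
theorem bubble_eq_zero_of_parity' {K V W : MKer (d + 1) (Fib d)} (hK : Spr K) (hKt : trK K = sgnK K) (hV : Loc V) (hW : Loc W)
    (hVt : trK V = -V) (hWt : trK W = -W) (hVs : sgnK V = V) (hWs : sgnK W = -W) : bubble K V W = 0 := by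
  have hKW : Loc (comp K W) := hK.comp_loc hW
  have hVK : Loc (comp V K) := hV.comp_spr hK
  have e1 : comp (-W) (sgnK K) = sgnK (comp W K) := by rw [comp_neg_left, comp_sgnK_right_of_eq_neg hWs, neg_neg]
  have e2 : comp (-V) (sgnK K) = -sgnK (comp V K) := by rw [comp_neg_left, comp_sgnK_right_of_eq_self hVs]
  have h1 : trK (comp (comp K V) (comp K W)) = -sgnK (comp (comp W K) (comp V K)) := by
    rw [trK_comp, trK_comp, trK_comp, hKt, hVt, hWt, e1, e2, comp_neg_right, comp_sgnK]
  have h2 : tr (comp (comp W K) (comp V K)) = tr (comp (comp K V) (comp K W)) := by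
    have hZ : Loc (comp K (comp V K)) := hK.comp_loc hVK
    rw [← comp_assoc_tame hW.tame hK.tame hVK.tame, tr_comp_comm_loc hW hZ.tame,
      ← comp_assoc_tame hK.tame hVK.tame hW.tame, ← comp_assoc_tame hV.tame hK.tame hW.tame,
      comp_assoc_tame hK.tame hV.tame hKW.tame]
  have h3 : tr (comp (comp K V) (comp K W)) = -tr (comp (comp K V) (comp K W)) := by
    conv_lhs => rw [← tr_trK (comp (comp K V) (comp K W)), h1]
    rw [tr_neg, tr_sgnK, h2]
  unfold ExpKernelCalculus.bubble
  linarith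

end Bubble

/-! ## §3 The propagator side: decimation, dressing and the step resolvents are sgn-symmetric -/

section Propagator

/-- [folklore] Transposition commutes with the block-contour decimation. -/
theorem trK_dec (M : ℕ) (K : MKer (d + 1) (Fib d)) : trK (dec M K) = dec M (trK K) := by
  funext x' y' a b
  simp only [trK_apply, OneStepKernelFamily.dec]
  rw [Finset.sum_comm]
  refine Finset.sum_congr rfl fun i _ => Finset.sum_congr rfl fun i' _ => ?_
  ring

/-- [folklore] The sign conjugation commutes with the block-contour decimation. -/
theorem sgnK_dec (M : ℕ) (K : MKer (d + 1) (Fib d)) : sgnK (dec M K) = dec M (sgnK K) := by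
  funext x' y' a b
  simp only [sgnK_apply, OneStepKernelFamily.dec, Finset.mul_sum]
  refine Finset.sum_congr rfl fun i _ => Finset.sum_congr rfl fun i' _ => ?_
  ring

/-- [folklore] **The decimated composite resolvent is sgn-symmetric**: `trK (KInvStep Lc j) = sgnK (KInvStep Lc j)`. -/
theorem trK_KInvStep (Lc : ℕ) [NeZero Lc] (j : ℕ) : trK (KInvStep (d := d) Lc j) = sgnK (KInvStep (d := d) Lc j) := by
  unfold OneStepKernelFamily.KInvStep
  rw [trK_dec, trK_KInv, sgnK_dec]

/-- [folklore] A decaying kernel in the `∃ δ C` currency is spread. -/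
theorem spr_of_decays {K : MKer (d + 1) (Fib d)} (hK : ∃ δ C : ℝ, 0 < δ ∧ 0 ≤ C ∧ Decays K C δ) : Spr K := by
  obtain ⟨δ, C, hδ, -, h⟩ := hK
  exact ⟨C, δ, hδ, h⟩

/-- [folklore] `KInvStep Lc j` is spread. -/
theorem spr_KInvStep (Lc : ℕ) [NeZero Lc] (j : ℕ) : Spr (KInvStep (d := d) Lc j) :=
  spr_of_decays (decays_KInvStep (d := d) (Lc := Lc) j)

/-- [folklore] The block-mean dressing projector has no mixed blocks, hence is fixed by `sgnK`. -/
theorem sgnK_piKBm (ρ : Fin (d + 1) → ℤ) (N : ℕ) : sgnK (piKBm (d := d) ρ N) = piKBm ρ N :=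
  sgnK_eq_self (fun x y κ l => piKBm_inl_inr ρ N x y κ l) (fun x y κ l => piKBm_inr_inl ρ N x y κ l)

/-- [folklore] **Co-dressing preserves sgn-symmetry**: for a spread sgn-symmetric `K` and an in-block root,
`trK (Π̂ᵀ K Π̂) = sgnK (Π̂ᵀ K Π̂)`. -/
theorem trK_coDressKBmAt {N : ℕ} (hN : 1 ≤ N) {r : Fin (d + 1) → ℕ} (hr : r ∈ box (d + 1) N) {K : MKer (d + 1) (Fib d)}
    (hK : Spr K) (hKt : trK K = sgnK K) :
    trK (coDressKBmAt (toSite r) N K) = sgnK (coDressKBmAt (toSite r) N K) := by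
  have hT : sgnK (trK (piKBm (d := d) (toSite r) N)) = trK (piKBm (toSite r) N) := by
    rw [← trK_sgnK, sgnK_piKBm]
  rw [coDressKBmAt_eq, trK_comp, trK_comp, trK_trK, hKt, comp_sgnK_left_of_eq_self (sgnK_piKBm _ _)]
  have h : comp (trK (piKBm (d := d) (toSite r) N)) (sgnK (comp K (piKBm (toSite r) N))) =
      comp (sgnK (trK (piKBm (d := d) (toSite r) N))) (sgnK (comp K (piKBm (toSite r) N))) := by rw [hT]
  rw [h, comp_sgnK, comp_assoc_tame (spr_trK_piKBm hN hr).tame hK.tame (spr_piKBm hN hr).tame]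

/-- [folklore] **The co-dressed step resolvents are sgn-symmetric** (every `j`, every in-block root). -/
theorem trK_coDressKBmAt_KInvStep {Lc : ℕ} [NeZero Lc] {r : Fin (d + 1) → ℕ} (hr : r ∈ box (d + 1) Lc) (j : ℕ) :
    trK (coDressKBmAt (toSite r) Lc (KInvStep (d := d) Lc j)) = sgnK (coDressKBmAt (toSite r) Lc (KInvStep (d := d) Lc j)) :=
  trK_coDressKBmAt (one_le_of_neZero Lc) hr (spr_KInvStep Lc j) (trK_KInvStep Lc j)

end Propagator

/-! ## §4 The vertex side: zero patterns and antisymmetry pass through `vertexOfK`; the coefficient split of `S0At` -/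

section Vertex

/-- [folklore] A zero pattern of the stencil family (a fixed fibre pair vanishing identically) passes to the chain-rule vertex. -/
theorem vertexOfK_apply_eq_zero {K : MKer (d + 1) (Fib d)} {N : ℕ} {S : Fin (d + 1) → (Fin (d + 1) → ℤ) → MKer (d + 1) (Fib d)}
    {a b : Fib d} (h : ∀ κ' u x z, S κ' u x z a b = 0) (μ : Fin (d + 1)) (y x z : Fin (d + 1) → ℤ) :
    vertexOfK K N S μ y x z a b = 0 := by
  simp only [OneStepKernelFamily.vertexOfK, OneStepResolventKernel.wsum, h, mul_zero, tsum_zero, Finset.sum_const_zero]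

/-- [folklore] Plain antisymmetry of every stencil passes to the chain-rule vertex. -/
theorem trK_vertexOfK_of_antisymm {K : MKer (d + 1) (Fib d)} {N : ℕ}
    {S : Fin (d + 1) → (Fin (d + 1) → ℤ) → MKer (d + 1) (Fib d)} (h : ∀ κ' u x z a b, S κ' u z x b a = -S κ' u x z a b)
    (μ : Fin (d + 1)) (y : Fin (d + 1) → ℤ) : trK (vertexOfK K N S μ y) = -vertexOfK K N S μ y := by
  funext x z a b
  simp only [trK_apply, Pi.neg_apply, OneStepKernelFamily.vertexOfK, OneStepResolventKernel.wsum]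
  rw [← Finset.sum_neg_distrib]
  refine Finset.sum_congr rfl fun κ' _ => ?_
  rw [← tsum_neg]
  refine tsum_congr fun u => ?_
  rw [h, mul_neg]

/-- [folklore] A coarse superposition of a family with a zero pattern has the zero pattern. -/
theorem cwsum_apply_eq_zero {N : ℕ} {w : (Fin (d + 1) → ℤ) → ℝ} {Q : (Fin (d + 1) → ℤ) → MKer (d + 1) (Fib d)}
    {x z : Fin (d + 1) → ℤ} {a b : Fib d} (h : ∀ y, Q y x z a b = 0) : cwsum N w Q x z a b = 0 := by
  have h0 : ∀ v, onLat N Q v x z a b = 0 := fun v => by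
    unfold InterLevelTransport.onLat
    split_ifs
    · exact h _
    · rfl
  simp only [InterLevelTransport.cwsum, OneStepResolventKernel.wsum, h0, mul_zero, tsum_zero]

/-- [folklore] `S^Λ` has the zero pattern of its second-jet tables. -/
theorem SLam_apply_eq_zero {N : ℕ} {c : Fin (d + 1) → (Fin (d + 1) → ℤ) → Fin (d + 1) → (Fin (d + 1) → ℤ) → ℝ}
    {Q2 : Fin (d + 1) → (Fin (d + 1) → ℤ) → MKer (d + 1) (Fib d)} {a b : Fib d} (h : ∀ μ y x z, Q2 μ y x z a b = 0)
    (κ' : Fin (d + 1)) (u x z : Fin (d + 1) → ℤ) : SLam N c Q2 κ' u x z a b = 0 := by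
  simp only [InterLevelTransport.SLam]
  rw [neg_eq_zero]
  exact Finset.sum_eq_zero fun μ _ => cwsum_apply_eq_zero fun y => h μ y x z

variable (d) (Lc : ℕ) [NeZero Lc]

/-- [folklore] **COEFFICIENT SPLIT** of the first-order spine: `S0At ρ cE cVH cΛ = S0At ρ 0 cVH 0 + S0At ρ cE 0 cΛ`
(the field–multiplier «vh» part plus the Wilson/Λ part). -/
theorem S0At_split (ρ : Fin (d + 1) → ℤ) (cE cVH cΛ : ℝ) :
    S0At d Lc ρ cE cVH cΛ = fun κ' u => S0At d Lc ρ 0 cVH 0 κ' u + S0At d Lc ρ cE 0 cΛ κ' u := by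
  funext κ' u x z a b
  simp only [S0At, Pi.add_apply, Pi.smul_apply, smul_eq_mul, zero_mul, zero_add, add_zero]
  ring

variable {d Lc}

/-- [folklore] The vh-part has no field–field block. -/
theorem S0At_vh_inl_inl (ρ : Fin (d + 1) → ℤ) (cVH : ℝ) (κ' : Fin (d + 1)) (u x z : Fin (d + 1) → ℤ) (α β : Fin (d + 1)) :
    S0At d Lc ρ 0 cVH 0 κ' u x z (Sum.inl α) (Sum.inl β) = 0 := by
  have h : vhSAt ρ d Lc rfl κ' u x z (Sum.inl α) (Sum.inl β) = 0 := rfl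
  simp only [S0At, Pi.add_apply, Pi.smul_apply, smul_eq_mul, zero_mul, add_zero, mfNeg_inl_inl, h, mul_zero]

/-- [folklore] The vh-part has no multiplier–multiplier block. -/
theorem S0At_vh_inr_inr (ρ : Fin (d + 1) → ℤ) (cVH : ℝ) (κ' : Fin (d + 1)) (u x z : Fin (d + 1) → ℤ) (m m' : Fin (d + 1)) :
    S0At d Lc ρ 0 cVH 0 κ' u x z (Sum.inr m) (Sum.inr m') = 0 := by
  have h : vhSAt ρ d Lc rfl κ' u x z (Sum.inr m) (Sum.inr m') = 0 := rfl
  simp only [S0At, Pi.add_apply, Pi.smul_apply, smul_eq_mul, zero_mul, add_zero, mfNeg_inr_inr, h, mul_zero]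

/-- [folklore] The Wilson/Λ-part has no field–multiplier block. -/
theorem S0At_wl_inl_inr (ρ : Fin (d + 1) → ℤ) (cE cΛ : ℝ) (κ' : Fin (d + 1)) (u x z : Fin (d + 1) → ℤ) (α m : Fin (d + 1)) :
    S0At d Lc ρ cE 0 cΛ κ' u x z (Sum.inl α) (Sum.inr m) = 0 := by
  have h1 : wilsonA d κ' u x z (Sum.inl α) (Sum.inr m) = 0 := rfl
  have h2 : SLam Lc (lamCoeffOf (KInv (N := Lc) (d := d)) Lc) (fun μ y => hessFFAt ρ Lc μ y) κ' u x z (Sum.inl α) (Sum.inr m) = 0 :=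
    SLam_apply_eq_zero (fun _ _ _ _ => rfl) κ' u x z
  simp only [S0At, Pi.add_apply, Pi.smul_apply, smul_eq_mul, zero_mul, add_zero, h1, h2, mul_zero]

/-- [folklore] The Wilson/Λ-part has no multiplier–field block. -/
theorem S0At_wl_inr_inl (ρ : Fin (d + 1) → ℤ) (cE cΛ : ℝ) (κ' : Fin (d + 1)) (u x z : Fin (d + 1) → ℤ) (m α : Fin (d + 1)) :
    S0At d Lc ρ cE 0 cΛ κ' u x z (Sum.inr m) (Sum.inl α) = 0 := by
  have h1 : wilsonA d κ' u x z (Sum.inr m) (Sum.inl α) = 0 := rfl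
  have h2 : SLam Lc (lamCoeffOf (KInv (N := Lc) (d := d)) Lc) (fun μ y => hessFFAt ρ Lc μ y) κ' u x z (Sum.inr m) (Sum.inl α) = 0 :=
    SLam_apply_eq_zero (fun _ _ _ _ => rfl) κ' u x z
  simp only [S0At, Pi.add_apply, Pi.smul_apply, smul_eq_mul, zero_mul, add_zero, h1, h2, mul_zero]

/-- [folklore] The chain-rule vertex of the vh-part is negated by `sgnK` (off-diagonal), any propagator `K`. -/
theorem sgnK_vertexOfK_S0At_vh (K : MKer (d + 1) (Fib d)) (ρ : Fin (d + 1) → ℤ) (cVH : ℝ) (μ : Fin (d + 1))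
    (y : Fin (d + 1) → ℤ) : sgnK (vertexOfK K Lc (S0At d Lc ρ 0 cVH 0) μ y) = -vertexOfK K Lc (S0At d Lc ρ 0 cVH 0) μ y :=
  sgnK_eq_neg_of_offDiag (fun x z κ l => vertexOfK_apply_eq_zero (fun κ' u x z => S0At_vh_inl_inl ρ cVH κ' u x z κ l) μ y x z)
    (fun x z κ l => vertexOfK_apply_eq_zero (fun κ' u x z => S0At_vh_inr_inr ρ cVH κ' u x z κ l) μ y x z)

/-- [folklore] The chain-rule vertex of the Wilson/Λ-part is fixed by `sgnK` (block-diagonal), any propagator `K`. -/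
theorem sgnK_vertexOfK_S0At_wl (K : MKer (d + 1) (Fib d)) (ρ : Fin (d + 1) → ℤ) (cE cΛ : ℝ) (μ : Fin (d + 1))
    (y : Fin (d + 1) → ℤ) : sgnK (vertexOfK K Lc (S0At d Lc ρ cE 0 cΛ) μ y) = vertexOfK K Lc (S0At d Lc ρ cE 0 cΛ) μ y :=
  sgnK_eq_self (fun x z κ l => vertexOfK_apply_eq_zero (fun κ' u x z => S0At_wl_inl_inr ρ cE cΛ κ' u x z κ l) μ y x z)
    (fun x z κ l => vertexOfK_apply_eq_zero (fun κ' u x z => S0At_wl_inr_inl ρ cE cΛ κ' u x z κ l) μ y x z)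

/-- [folklore] The chain-rule vertex of (any coefficient slice of) the spine is plain-antisymmetric. -/
theorem trK_vertexOfK_S0At (K : MKer (d + 1) (Fib d)) (ρ : Fin (d + 1) → ℤ) (cE cVH cΛ : ℝ) (μ : Fin (d + 1))
    (y : Fin (d + 1) → ℤ) : trK (vertexOfK K Lc (S0At d Lc ρ cE cVH cΛ) μ y) = -vertexOfK K Lc (S0At d Lc ρ cE cVH cΛ) μ y :=
  trK_vertexOfK_of_antisymm (fun κ' u x z a b => S0At_antisymm ρ cE cVH cΛ κ' u x z a b) μ y

/-- [folklore] The chain-rule vertices of the rooted spine through the co-dressed step resolvent are localised. -/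
theorem loc_vertexOfK_S0At {r : Fin (d + 1) → ℕ} (hr : r ∈ box (d + 1) Lc) (j : ℕ) (cE cVH cΛ : ℝ) (μ : Fin (d + 1))
    (y : Fin (d + 1) → ℤ) :
    Loc (vertexOfK (coDressKBmAt (toSite r) Lc (KInvStep (d := d) Lc j)) Lc (S0At d Lc (toSite r) cE cVH cΛ) μ y) := by
  obtain ⟨Cs, δ, hδ, hS⟩ := locStencil_S0At (d := d) (one_le_of_neZero Lc) hr cE cVH cΛ
  obtain ⟨Cv, δv, hδv, hV⟩ := vertexFamily_vertexOfK' (N := Lc) (decays_coDressKBmAt_KInvStep (d := d) hr j) hS hδ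
  exact ⟨_, _, Cv, δv, hδv, hV μ y⟩

end Vertex

/-! ## §5 The consequence for the typed step kernels: the vh-part never meets the Wilson/Λ-part in a bubble -/

section Spine

variable {Lc : ℕ} [NeZero Lc]

/-- [folklore] **THE vh-PART OF THE SPINE IS BUBBLE-ORTHOGONAL TO ITS WILSON/Λ-PART** through the co-dressed step resolvent
`G_j = coDressKBmAt (toSite r) Lc (KInvStep Lc j)`: every `j`, every in-block root, all coefficients, all coarse bonds. -/
theorem bubble_S0At_vh_wl_eq_zero {r : Fin (d + 1) → ℕ} (hr : r ∈ box (d + 1) Lc) (j : ℕ) (cE cVH cΛ : ℝ) (μ : Fin (d + 1))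
    (y : Fin (d + 1) → ℤ) (ν : Fin (d + 1)) (y' : Fin (d + 1) → ℤ) :
    bubble (coDressKBmAt (toSite r) Lc (KInvStep (d := d) Lc j))
      (vertexOfK (coDressKBmAt (toSite r) Lc (KInvStep (d := d) Lc j)) Lc (S0At d Lc (toSite r) 0 cVH 0) μ y)
      (vertexOfK (coDressKBmAt (toSite r) Lc (KInvStep (d := d) Lc j)) Lc (S0At d Lc (toSite r) cE 0 cΛ) ν y') = 0 :=
  bubble_eq_zero_of_parity (spr_coDressKBmAt (one_le_of_neZero Lc) hr (spr_KInvStep Lc j)) (trK_coDressKBmAt_KInvStep hr j)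
    (loc_vertexOfK_S0At hr j 0 cVH 0 μ y) (loc_vertexOfK_S0At hr j cE 0 cΛ ν y') (trK_vertexOfK_S0At _ _ 0 cVH 0 μ y)
    (trK_vertexOfK_S0At _ _ cE 0 cΛ ν y') (sgnK_vertexOfK_S0At_vh _ _ cVH μ y) (sgnK_vertexOfK_S0At_wl _ _ cE cΛ ν y')

/-- [folklore] The mirrored statement: Wilson/Λ-part first, vh-part second. -/
theorem bubble_S0At_wl_vh_eq_zero {r : Fin (d + 1) → ℕ} (hr : r ∈ box (d + 1) Lc) (j : ℕ) (cE cVH cΛ : ℝ) (μ : Fin (d + 1))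
    (y : Fin (d + 1) → ℤ) (ν : Fin (d + 1)) (y' : Fin (d + 1) → ℤ) :
    bubble (coDressKBmAt (toSite r) Lc (KInvStep (d := d) Lc j))
      (vertexOfK (coDressKBmAt (toSite r) Lc (KInvStep (d := d) Lc j)) Lc (S0At d Lc (toSite r) cE 0 cΛ) μ y)
      (vertexOfK (coDressKBmAt (toSite r) Lc (KInvStep (d := d) Lc j)) Lc (S0At d Lc (toSite r) 0 cVH 0) ν y') = 0 :=
  bubble_eq_zero_of_parity' (spr_coDressKBmAt (one_le_of_neZero Lc) hr (spr_KInvStep Lc j)) (trK_coDressKBmAt_KInvStep hr j)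
    (loc_vertexOfK_S0At hr j cE 0 cΛ μ y) (loc_vertexOfK_S0At hr j 0 cVH 0 ν y') (trK_vertexOfK_S0At _ _ cE 0 cΛ μ y)
    (trK_vertexOfK_S0At _ _ 0 cVH 0 ν y') (sgnK_vertexOfK_S0At_wl _ _ cE cΛ μ y) (sgnK_vertexOfK_S0At_vh _ _ cVH ν y')

end Spine

end

end Summit.QuantumFields.BalabanUV.Beta.BubbleParity
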